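import Mathlib
import Literature.Algebra.Polynomial.CorrelativeSparsityCertificates
import HarnessLib

/-!
# Without the running intersection property sparse SOS relaxations need not converge:
# Nie–Demmel's minimum-cover-set counterexample, exactly (sparse bound `= 3/2 < 2 = f*`)

Topic `Literature/Algebra/Polynomial`, namespace
`Literature.Algebra.Polynomial.SparseSosWithoutRunningIntersection`.  The second CEILING companion
of `SparsePutinarPositivstellensatz.lean` (Lasserre 2006 / Grimm–Netzer–Schweighofer 2007: under
the running intersection property (RIP) and archimedean block modules, sparse Putinar
certificates exist and the sparse hierarchy converges) — the first, `SparseSosWithoutCompactness`,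
removes compactness; this one keeps compactness (the feasible set is finite) and removes the RIP.

## Source, read on the page

J. Nie, J. Demmel, *Sparse SOS relaxations for minimizing functions that are summations of small
polynomials*, SIAM J. Optim. 19 (2008) 1534–1558 [held text `paper:arxiv-math_0606476`, §7
«Conclusions and discussions», arXiv p. 17]: «Lasserre [Las_sparse] proved the convergence under
the running intersection property.  However, unlike the general dense SOS relaxation for
minimizing polynomials over compact sets, the convergence might fail when the running
intersection property does not hold.  As a counterexample, consider the Minimum Cover Set
Problem.  Let `G = (V,E)` be a graph with vertex set `V = [3]` and edge set
`E = {(1,2),(1,3),(2,3)}`.  To find the minimum cover set is equivalent to solving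
`min f_1(x_{Δ_1}) + f_2(x_{Δ_2}) + f_3(x_{Δ_3})` s.t. `x_1² = x_1, x_2² = x_2, x_3² = x_3`,
`x_1 + x_2 ≥ 1, x_1 + x_3 ≥ 1, x_2 + x_3 ≥ 1`, where `Δ_1 = {1,2}, Δ_2 = {1,3}, Δ_3 = {2,3}` and
`f_1 = ½(x_1 + x_2), f_2 = ½(x_1 + x_3), f_3 = ½(x_2 + x_3)`.  The running intersection property
now fails.  However, we can prove that the global minimum `f* = 2` and the lower bounds given by
sparse SOS relaxations are at most `3/2`.  The sparse SOS relaxations do not converge for this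
example.»  The sparse relaxation meant is Lasserre's `Q*_r` [Lasserre 2006, (3.12) (p. 9)]:
`sup λ` s.t. `f − λ = Σ_k (q_k + Σ_{j ∈ J_k} q_{jk} g_j)`, `q_k, q_{jk}` s.o.s. in `ℝ[X(I_k)]`,
every constraint `g_j`, `j ∈ J_k`, involving the variables `X(I_k)` only [Assumption 3.2 (p. 6)].

## What is formalised (all proved; no named facts)

Variables `x_0, x_1, x_2` (`Fin 3`; the paper's `x_1, x_2, x_3`); blocks `Δ 0 = {0,1}`,
`Δ 1 = {0,2}`, `Δ 2 = {1,2}`; `fb k = ½ Σ_{i ∈ Δ k} x_i`, `f = Σ_k fb k = x_0 + x_1 + x_2`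
(`f_eq`); constraints `bool i = x_i² − x_i` (`= 0`) and `edge k = Σ_{i ∈ Δ k} x_i − 1` (`≥ 0`);
feasible set `K`; BLOCK-feasible sets `Kb k` (only the constraints written in the variables of
block `k`: `bool i`, `i ∈ Δ k`, and `edge k`).
* `not_indexedRunningIntersection` — the RIP fails for EVERY ordering of the three blocks.
* ★ `isLeast_eval_f` — `f* = min_K f = 2`, attained at `(1,1,0)`.
* ★★ `le_three_halves_of_block_nonneg` — THE OBSTRUCTION, in its strongest form: if
  `f − γ = Σ_k q_k + Σ_i h_i · bool i` with each `q_k ∈ ℝ[x_{Δ k}]` merely NONNEGATIVE ON `Kb k`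
  (this covers every block term `q_k + Σ_j q_{jk} g_j` of (3.12), sums of squares of ANY degree,
  and equality constraints with arbitrary multipliers) and `h_i ∈ ℝ[x]` ARBITRARY, then
  `γ ≤ 3/2`.  Proof (the paper says «we can prove»; no proof is printed — this is ours): the
  signed pseudo-moment functional `L(p) = ½ (p(1,1,0) + p(1,0,1) + p(0,1,1)) − ½ p(1,1,1)` has
  `L(1) = 1`, `L(f) = 3/2`, kills the Boolean ideal, and restricted to `ℝ[x_{Δ k}]` equals
  `½ (δ_a + δ_b)` for two points `a, b ∈ Kb k` — so `L ≥ 0` on every admissible block term.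
* ★★ `hasSparseCertificate_iff` / `sparseBound_eq` — the set of `γ` with a sparse certificate
  (3.12) (no degree bound) is EXACTLY `(−∞, 3/2]`: `γ = 3/2` is attained already with constant
  multipliers, `f − 3/2 = Σ_k ½ · edge k`.  So the sparse bound is `3/2` at every relaxation
  order `r ≥ 1`, while `f* = 2` (printed: «at most 3/2»).
* ★ `hasDenseCertificate_iff` / `denseBound_eq` — the contrast: the DENSE Putinar certificates
  (one s.o.s. `σ₀ ∈ ℝ[x_0,x_1,x_2]`, s.o.s. multipliers of the `edge k`, the Boolean ideal) certify
  exactly `(−∞, 2]`, i.e. the dense relaxation is exact, by the explicit degree-5 identity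
  `dense_certificate` (`σ₀ = (1 − e₁ + e₂)²`, `σ_k = (Π_{i∈Δ k}(1 − x_i))²`).
* `cspGraph_eq_top` — the tie to `CorrelativeSparsityCertificates`: Waki's correlative
  sparsity graph of this problem is the triangle (complete), whose only maximal clique is
  `{0,1,2}`; the chordal-csp recipe therefore returns the dense (exact) relaxation here, never the
  RIP-violating cover `Δ`.
Also: `isBlockSos_iff` — a polynomial is a block-SOS (`CorrelativeSparsityCertificates.IsBlockSos`)
iff it is a sum of squares lying in the block subalgebra (API used here, general `σ`).

Not claimed: anything about degree-bounded relaxation VALUES beyond what the two-sided set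
identities give (they hold at every order `r ≥ 1` for the sparse side and every order admitting
the degree-5 identity for the dense side).

## References

* [NieDemmel2008] J. Nie, J. Demmel, SIAM J. Optim. 19 (2008) 1534–1558, doi:10.1137/060668791
  (arXiv:math/0606476) — §7, the minimum-cover-set counterexample.
* [Lasserre2006] J. B. Lasserre, *Convergent SDP-relaxations in polynomial optimization with
  sparsity*, SIAM J. Optim. 17 (2006) 822–843 — Assumption 3.2 (p. 6), (3.12) (p. 9).
* [WakiEtAl2006] H. Waki, S. Kim, M. Kojima, M. Muramatsu, SIAM J. Optim. 17 (2006) 218–242 —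
  §3.2 (the csp graph), through `CorrelativeSparsityCertificates.cspGraph`.
-/

noncomputable section

open MvPolynomial Finset

open scoped BigOperators

namespace Literature.Algebra.Polynomial.SparseSosWithoutRunningIntersection

open Literature.Algebra.Polynomial.SparsePutinarPositivstellensatz (eval_eq_of_mem_supported
  C_mem_supported rename_mem_supported)
open Literature.Algebra.Polynomial.CorrelativeSparsityCertificates (IsBlockSos isSumSq_rename
  cspGraph)
open Literature.Algebra.Polynomial.PutinarPositivstellensatz (eval_nonneg_of_isSumSq)
open Literature.Combinatorics.SimpleGraph (IndexedRunningIntersection mem_iUnionLT)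

/-! ### §0 API: block sums of squares are the sums of squares of the block subalgebra -/

section API

variable {σ : Type*}

/-- The projection `ℝ[x] → ℝ[x_I]` killing the variables outside `I` (`ℝ[x_I] ⊆ ℝ[x]` the subring of
polynomials in the variables of `I`). [cite: GrimmNetzerSchweighofer2007, §2 first paragraph] -/
def blockProj (I : Set σ) [DecidablePred (· ∈ I)] : MvPolynomial σ ℝ →ₐ[ℝ] MvPolynomial I ℝ :=
  aeval fun i => if h : i ∈ I then X ⟨i, h⟩ else 0

/-- `rename ∘ blockProj = id` on `ℝ[x_I]`. [cite: GrimmNetzerSchweighofer2007, §2 first paragraph] -/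
theorem rename_blockProj {I : Set σ} [DecidablePred (· ∈ I)] {s : MvPolynomial σ ℝ}
    (hs : s ∈ supported ℝ I) : rename ((↑) : I → σ) (blockProj I s) = s := by
  rw [mem_supported] at hs
  have key : ((rename ((↑) : I → σ)).comp (blockProj I)) s = (AlgHom.id ℝ _) s := by
    refine hom_congr_vars ?_ (fun i hi _ => ?_) rfl
    · ext a
      simp [blockProj]
    · have hiI : i ∈ I := hs hi
      simp [blockProj, hiI]
  simpa using key

/-- Ring homomorphisms preserve sums of squares. [folklore] -/
private theorem isSumSq_map {R S F : Type*} [CommSemiring R] [CommSemiring S] [FunLike F R S]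
    [RingHomClass F R S] (φ : F) {a : R} (h : IsSumSq a) : IsSumSq (φ a) := by
  induction h with
  | zero => rw [map_zero]; exact IsSumSq.zero
  | sq_add x hS ih =>
    rw [map_add, map_mul]
    exact IsSumSq.sq_add _ ih

/-- The tree's `IsBlockSos I s` (a `rename` of a sum of squares of `ℝ[x_I]`) is exactly the printed
notion «`q ∈ ℝ[X(I_k)]` and s.o.s.»: a sum of squares of `ℝ[x]` lying in `ℝ[x_I]` (substitute `0`
for the variables outside `I` in the squares). [cite: Lasserre2006, (3.12) (p. 9)] -/
theorem isBlockSos_iff {I : Set σ} {s : MvPolynomial σ ℝ} :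
    IsBlockSos I s ↔ IsSumSq s ∧ s ∈ supported ℝ I := by
  classical
  refine ⟨fun h => h.isSumSq_and_mem, fun ⟨hsq, hmem⟩ => ?_⟩
  exact ⟨blockProj I s, isSumSq_map (blockProj I) hsq, (rename_blockProj hmem).symm⟩

/-- A nonnegative constant is «in `ℝ[X(I_k)]` and s.o.s.». [cite: Lasserre2006, (3.12) (p. 9)] -/
theorem isBlockSos_C (I : Set σ) {c : ℝ} (hc : 0 ≤ c) : IsBlockSos I (C c : MvPolynomial σ ℝ) := by
  refine isBlockSos_iff.2 ⟨?_, C_mem_supported I c⟩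
  rw [← Real.mul_self_sqrt hc, C_mul]
  exact IsSumSq.mul_self _

/-- «`q ∈ ℝ[X(I_k)]` and s.o.s.» polynomials are s.o.s. [cite: Lasserre2006, (3.12) (p. 9)] -/
theorem _root_.Literature.Algebra.Polynomial.CorrelativeSparsityCertificates.IsBlockSos.isSumSq
    {I : Set σ} {s : MvPolynomial σ ℝ} (h : IsBlockSos I s) : IsSumSq s :=
  h.isSumSq_and_mem.1

end API

/-! ### §1 The data of the counterexample -/

/-- The three blocks `Δ_1 = {x_0,x_1}`, `Δ_2 = {x_0,x_2}`, `Δ_3 = {x_1,x_2}` (the three edges of the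
triangle). [cite: NieDemmel2008, §7 (arXiv p. 17)] -/
def Δ : Fin 3 → Finset (Fin 3) := ![{0, 1}, {0, 2}, {1, 2}]

/-- [cite: NieDemmel2008, §7 (arXiv p. 17)] -/
@[simp] theorem Δ_zero : Δ 0 = {0, 1} := rfl

/-- [cite: NieDemmel2008, §7 (arXiv p. 17)] -/
@[simp] theorem Δ_one : Δ 1 = {0, 2} := rfl

/-- [cite: NieDemmel2008, §7 (arXiv p. 17)] -/
@[simp] theorem Δ_two : Δ 2 = {1, 2} := rfl

/-- `f_k = ½ Σ_{i ∈ Δ_k} x_i`. [cite: NieDemmel2008, §7 (arXiv p. 17)] -/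
def fb (k : Fin 3) : MvPolynomial (Fin 3) ℝ := C (1 / 2) * ∑ i ∈ Δ k, X i

/-- `f = f_1 + f_2 + f_3` (the number of chosen vertices). [cite: NieDemmel2008, §7 (arXiv p. 17)] -/
def f : MvPolynomial (Fin 3) ℝ := ∑ k, fb k

/-- The Boolean constraint `x_i² − x_i` (`= 0`). [cite: NieDemmel2008, §7 (arXiv p. 17)] -/
def bool (i : Fin 3) : MvPolynomial (Fin 3) ℝ := X i ^ 2 - X i

/-- The covering constraint of edge `k`: `Σ_{i ∈ Δ_k} x_i − 1` (`≥ 0`).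
[cite: NieDemmel2008, §7 (arXiv p. 17)] -/
def edge (k : Fin 3) : MvPolynomial (Fin 3) ℝ := ∑ i ∈ Δ k, X i - 1

/-- The feasible set `K = {x ∈ {0,1}³ | every edge covered}`. [cite: NieDemmel2008, §7 (arXiv p. 17)] -/
def K : Set (Fin 3 → ℝ) := {x | (∀ i, eval x (bool i) = 0) ∧ ∀ k, 0 ≤ eval x (edge k)}

/-- The BLOCK-feasible set of block `k`: the constraints written in the variables `x_{Δ_k}` only
(`bool i`, `i ∈ Δ_k`, and `edge k`) — Lasserre's `J_k`. [cite: Lasserre2006, Assumption 3.2 (i) (p. 6)] -/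
def Kb (k : Fin 3) : Set (Fin 3 → ℝ) := {x | (∀ i ∈ Δ k, eval x (bool i) = 0) ∧ 0 ≤ eval x (edge k)}

/-- [cite: NieDemmel2008, §7 (arXiv p. 17)] -/
@[simp] theorem eval_bool (x : Fin 3 → ℝ) (i : Fin 3) : eval x (bool i) = x i ^ 2 - x i := by
  simp [bool]

/-- [cite: NieDemmel2008, §7 (arXiv p. 17)] -/
@[simp] theorem eval_edge (x : Fin 3 → ℝ) (k : Fin 3) :
    eval x (edge k) = ∑ i ∈ Δ k, x i - 1 := by
  simp [edge, map_sum]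

/-- `K ⊆ Kb k`. [cite: Lasserre2006, Assumption 3.2 (i) (p. 6)] -/
theorem K_subset_Kb (k : Fin 3) : K ⊆ Kb k := fun _ hx => ⟨fun i _ => hx.1 i, hx.2 k⟩

/-- `C ½ + C ½ = 1`. [folklore] -/
private theorem C_half_add : (C (1 / 2 : ℝ) : MvPolynomial (Fin 3) ℝ) + C (1 / 2) = 1 := by
  rw [← map_add, ← C_1]; norm_num

/-- `f = x_0 + x_1 + x_2`. [cite: NieDemmel2008, §7 (arXiv p. 17)] -/
theorem f_eq : f = X 0 + X 1 + X 2 := by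
  simp only [f, fb, Fin.sum_univ_three, Δ_zero, Δ_one, Δ_two]
  rw [Finset.sum_pair (by decide), Finset.sum_pair (by decide), Finset.sum_pair (by decide)]
  linear_combination (X 0 + X 1 + X 2 : MvPolynomial (Fin 3) ℝ) * C_half_add

/-- [cite: NieDemmel2008, §7 (arXiv p. 17)] -/
@[simp] theorem eval_f (x : Fin 3 → ℝ) : eval x f = x 0 + x 1 + x 2 := by
  simp [f_eq]

/-- `f_k ∈ ℝ[x_{Δ_k}]` (Assumption 3.2 (ii)). [cite: Lasserre2006, Assumption 3.2 (ii) (p. 6)] -/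
theorem fb_mem_supported (k : Fin 3) : fb k ∈ supported ℝ (Δ k : Set (Fin 3)) :=
  Subalgebra.mul_mem _ (C_mem_supported _ _)
    (Subalgebra.sum_mem _ fun _ hi => (X_mem_supported (R := ℝ)).2 (Finset.mem_coe.2 hi))

/-- `edge k ∈ ℝ[x_{Δ_k}]` (Assumption 3.2 (i)). [cite: Lasserre2006, Assumption 3.2 (i) (p. 6)] -/
theorem edge_mem_supported (k : Fin 3) : edge k ∈ supported ℝ (Δ k : Set (Fin 3)) :=
  Subalgebra.sub_mem _
    (Subalgebra.sum_mem _ fun _ hi => (X_mem_supported (R := ℝ)).2 (Finset.mem_coe.2 hi))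
    (Subalgebra.one_mem _)

/-- `bool i ∈ ℝ[x_{Δ_k}]` for `i ∈ Δ_k` (Assumption 3.2 (i)).
[cite: Lasserre2006, Assumption 3.2 (i) (p. 6)] -/
theorem bool_mem_supported {k i : Fin 3} (hi : i ∈ Δ k) :
    bool i ∈ supported ℝ (Δ k : Set (Fin 3)) :=
  Subalgebra.sub_mem _ (Subalgebra.pow_mem _ ((X_mem_supported (R := ℝ)).2 (Finset.mem_coe.2 hi)) _)
    ((X_mem_supported (R := ℝ)).2 (Finset.mem_coe.2 hi))

/-! ### §2 The running intersection property fails, in every order -/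

/-- Two distinct blocks cover all three variables. [cite: NieDemmel2008, §7 (arXiv p. 17)] -/
theorem mem_Δ_or_mem_Δ : ∀ {a b : Fin 3}, a ≠ b → ∀ v : Fin 3, v ∈ Δ a ∨ v ∈ Δ b := by decide

/-- Two distinct blocks are incomparable. [cite: NieDemmel2008, §7 (arXiv p. 17)] -/
theorem exists_mem_Δ_not_mem : ∀ {a b : Fin 3}, a ≠ b → ∃ v, v ∈ Δ a ∧ v ∉ Δ b := by decide

/-- Two distinct blocks share exactly one variable. [cite: NieDemmel2008, §7 (arXiv p. 17)] -/
theorem card_Δ_inter_Δ : ∀ {a b : Fin 3}, a ≠ b → (Δ a ∩ Δ b).card = 1 := by decide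

/-- Every block has two variables. [cite: NieDemmel2008, §7 (arXiv p. 17)] -/
theorem card_Δ : ∀ k : Fin 3, (Δ k).card = 2 := by decide

/-- Every pair of distinct variables is a block. [cite: NieDemmel2008, §7 (arXiv p. 17)] -/
theorem exists_pair_subset_Δ : ∀ {i j : Fin 3}, i ≠ j → ∃ k, i ∈ Δ k ∧ j ∈ Δ k := by decide

/-- «The running intersection property now fails» — for EVERY ordering `π` of the three blocks:
the last block meets the union of the first two (all of `{x_0,x_1,x_2}`) in itself, which lies in
neither earlier block. [cite: NieDemmel2008, §7 (arXiv p. 17)] -/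
theorem not_indexedRunningIntersection (π : Equiv.Perm (Fin 3)) :
    ¬ IndexedRunningIntersection fun j => (Δ (π j) : Set (Fin 3)) := by
  intro h
  obtain ⟨j, hj, hsub⟩ := h 2 (by simp)
  have hj2 : π j ≠ π 2 := fun e => (ne_of_lt hj) (π.injective e)
  obtain ⟨v, hv2, hvj⟩ := exists_mem_Δ_not_mem hj2.symm
  refine hvj (Finset.mem_coe.1 (hsub ⟨Finset.mem_coe.2 hv2, ?_⟩))
  rw [mem_iUnionLT]
  have h01 : π 0 ≠ π 1 := fun e => absurd (π.injective e) (by decide)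
  rcases mem_Δ_or_mem_Δ h01 v with h0 | h1
  · exact ⟨0, by decide, Finset.mem_coe.2 h0⟩
  · exact ⟨1, by decide, Finset.mem_coe.2 h1⟩

/-! ### §3 `f* = 2` -/

/-- The `0/1` point with support `S`. [cite: NieDemmel2008, §7 (arXiv p. 17)] -/
def ind (S : Finset (Fin 3)) : Fin 3 → ℝ := fun i => if i ∈ S then 1 else 0

/-- [cite: NieDemmel2008, §7 (arXiv p. 17)] -/
@[simp] theorem ind_apply (S : Finset (Fin 3)) (i : Fin 3) :
    ind S i = if i ∈ S then 1 else 0 := rfl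

/-- On `K`, `f ≥ 2` (two vertices are needed to cover a triangle). [cite: NieDemmel2008, §7 (arXiv p. 17)] -/
theorem two_le_eval_f {x : Fin 3 → ℝ} (hx : x ∈ K) : 2 ≤ eval x f := by
  obtain ⟨hb, he⟩ := hx
  have h01 : ∀ i, x i = 0 ∨ x i = 1 := fun i => by
    have h := hb i
    rw [eval_bool] at h
    have : x i * (x i - 1) = 0 := by linear_combination h
    rcases mul_eq_zero.1 this with h0 | h1
    · exact Or.inl h0
    · exact Or.inr (by linarith)
  have e0 := he 0
  have e1 := he 1
  have e2 := he 2
  simp only [eval_edge, Δ_zero, Δ_one, Δ_two, Finset.sum_pair (show (0 : Fin 3) ≠ 1 by decide),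
    Finset.sum_pair (show (0 : Fin 3) ≠ 2 by decide),
    Finset.sum_pair (show (1 : Fin 3) ≠ 2 by decide)] at e0 e1 e2
  rw [eval_f]
  rcases h01 0 with h0 | h0 <;> rcases h01 1 with h1 | h1 <;> rcases h01 2 with h2 | h2 <;>
    linarith

/-- A `0/1` point satisfies the Boolean constraints. [cite: NieDemmel2008, §7 (arXiv p. 17)] -/
@[simp] theorem eval_ind_bool (S : Finset (Fin 3)) (i : Fin 3) : eval (ind S) (bool i) = 0 := by
  rw [eval_bool, ind_apply]
  split_ifs <;> norm_num

/-- `edge k` at the `0/1` point with support `S` counts `|Δ_k ∩ S| − 1`.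
[cite: NieDemmel2008, §7 (arXiv p. 17)] -/
theorem eval_ind_edge (S : Finset (Fin 3)) (k : Fin 3) :
    eval (ind S) (edge k) = ((Δ k ∩ S).card : ℝ) - 1 := by
  rw [eval_edge]
  simp only [ind_apply]
  rw [Finset.sum_ite_mem, Finset.sum_const, nsmul_eq_mul, mul_one]

/-- `f` at the `0/1` point with support `S` is `|S|`. [cite: NieDemmel2008, §7 (arXiv p. 17)] -/
theorem eval_ind_f (S : Finset (Fin 3)) : eval (ind S) f = (S.card : ℝ) := by
  rw [eval_f]
  have : ind S 0 + ind S 1 + ind S 2 = ∑ i, ind S i := by rw [Fin.sum_univ_three]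
  rw [this]
  simp only [ind_apply]
  rw [Finset.sum_ite_mem, Finset.univ_inter, Finset.sum_const, nsmul_eq_mul, mul_one]

/-- `(1,1,0) ∈ K`. [cite: NieDemmel2008, §7 (arXiv p. 17)] -/
theorem ind_Δ_zero_mem_K : ind (Δ 0) ∈ K := by
  refine ⟨fun i => eval_ind_bool _ i, fun k => ?_⟩
  rw [eval_ind_edge, sub_nonneg, Nat.one_le_cast]
  exact (by decide : ∀ k : Fin 3, 1 ≤ (Δ k ∩ Δ 0).card) k

/-- `f(1,1,0) = 2`. [cite: NieDemmel2008, §7 (arXiv p. 17)] -/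
theorem eval_ind_Δ_zero_f : eval (ind (Δ 0)) f = 2 := by
  rw [eval_ind_f, card_Δ]; norm_num

/-- ★ «the global minimum `f* = 2`». [cite: NieDemmel2008, §7 (arXiv p. 17)] -/
theorem isLeast_eval_f : IsLeast ((fun x => eval x f) '' K) 2 :=
  ⟨⟨ind (Δ 0), ind_Δ_zero_mem_K, eval_ind_Δ_zero_f⟩, by
    rintro _ ⟨x, hx, rfl⟩
    exact two_le_eval_f hx⟩

/-! ### §4 The pseudo-moment functional and the obstruction `γ ≤ 3/2` -/

/-- The signed pseudo-moment functional
`L(p) = ½ (p(1,1,0) + p(1,0,1) + p(0,1,1)) − ½ p(1,1,1)` (the three weight-two points are the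
indicator vectors of the three blocks). [cite: NieDemmel2008, §7 (arXiv p. 17)] -/
def L (p : MvPolynomial (Fin 3) ℝ) : ℝ :=
  (1 / 2) * ∑ k, eval (ind (Δ k)) p - (1 / 2) * eval (ind Finset.univ) p

/-- [cite: NieDemmel2008, §7 (arXiv p. 17)] -/
theorem L_add (p q : MvPolynomial (Fin 3) ℝ) : L (p + q) = L p + L q := by
  simp only [L, map_add, Finset.sum_add_distrib]
  ring

/-- [cite: NieDemmel2008, §7 (arXiv p. 17)] -/
theorem L_sub (p q : MvPolynomial (Fin 3) ℝ) : L (p - q) = L p - L q := by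
  simp only [L, map_sub, Finset.sum_sub_distrib]
  ring

/-- [cite: NieDemmel2008, §7 (arXiv p. 17)] -/
theorem L_sum {ι : Type*} (s : Finset ι) (q : ι → MvPolynomial (Fin 3) ℝ) :
    L (∑ j ∈ s, q j) = ∑ j ∈ s, L (q j) := by
  classical
  induction s using Finset.induction_on with
  | empty => simp [L]
  | insert j s hj ih => rw [Finset.sum_insert hj, Finset.sum_insert hj, L_add, ih]

/-- `L(γ) = γ` (`L(1) = 1`). [cite: NieDemmel2008, §7 (arXiv p. 17)] -/
theorem L_C (a : ℝ) : L (C a) = a := by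
  simp only [L, eval_C, Finset.sum_const, Finset.card_univ, Fintype.card_fin, nsmul_eq_mul]
  push_cast
  ring

/-- `L(f) = 3/2`. [cite: NieDemmel2008, §7 (arXiv p. 17)] -/
theorem L_f : L f = 3 / 2 := by
  simp only [L, eval_ind_f, card_Δ, Finset.card_univ, Fintype.card_fin, Finset.sum_const,
    nsmul_eq_mul]
  norm_num

/-- `L` kills the Boolean ideal (it is supported on `0/1` points).
[cite: NieDemmel2008, §7 (arXiv p. 17)] -/
theorem L_mul_bool (h : MvPolynomial (Fin 3) ℝ) (i : Fin 3) : L (h * bool i) = 0 := by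
  simp only [L, map_mul, eval_ind_bool, mul_zero, Finset.sum_const_zero, sub_zero]

/-- On `ℝ[x_{Δ_k}]`, `L = ½ (δ_a + δ_b)` where `a, b` are the indicator vectors of the two OTHER
blocks. [cite: NieDemmel2008, §7 (arXiv p. 17)] -/
theorem L_of_mem_supported {k : Fin 3} {q : MvPolynomial (Fin 3) ℝ}
    (hq : q ∈ supported ℝ (Δ k : Set (Fin 3))) :
    L q = (1 / 2) * ∑ k' ∈ Finset.univ.erase k, eval (ind (Δ k')) q := by
  have hk : eval (ind (Δ k)) q = eval (ind Finset.univ) q :=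
    eval_eq_of_mem_supported hq fun i hi => by
      simp [Finset.mem_coe.1 hi]
  rw [L, ← Finset.add_sum_erase _ _ (Finset.mem_univ k), hk]
  ring

/-- The indicator vector of block `k' ≠ k` is BLOCK-feasible for block `k` (it covers edge `k`
with exactly one vertex). [cite: NieDemmel2008, §7 (arXiv p. 17)] -/
theorem ind_mem_Kb {k k' : Fin 3} (hkk' : k' ≠ k) : ind (Δ k') ∈ Kb k := by
  refine ⟨fun i _ => eval_ind_bool _ i, ?_⟩
  rw [eval_ind_edge, card_Δ_inter_Δ hkk'.symm]
  norm_num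

/-- `L ≥ 0` on every block polynomial nonnegative on its block-feasible set.
[cite: NieDemmel2008, §7 (arXiv p. 17)] -/
theorem L_nonneg_of_block {k : Fin 3} {q : MvPolynomial (Fin 3) ℝ}
    (hq : q ∈ supported ℝ (Δ k : Set (Fin 3))) (hpos : ∀ x ∈ Kb k, 0 ≤ eval x q) : 0 ≤ L q := by
  rw [L_of_mem_supported hq]
  exact mul_nonneg (by norm_num)
    (Finset.sum_nonneg fun k' hk' => hpos _ (ind_mem_Kb (Finset.ne_of_mem_erase hk')))

/-- ★★ **The obstruction** («the lower bounds given by sparse SOS relaxations are at most 3/2»), in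
the strongest form: if `f − γ = Σ_k q_k + Σ_i h_i (x_i² − x_i)` with every `q_k ∈ ℝ[x_{Δ_k}]`
merely nonnegative on the block-feasible set `Kb k` — this covers each block term
`q_k + Σ_{j∈J_k} q_{jk} g_j` of Lasserre's sparse certificate (3.12) with s.o.s. `q`'s of ANY
degree — and ARBITRARY `h_i ∈ ℝ[x]`, then `γ ≤ 3/2` (`< 2 = f*`).
[cite: NieDemmel2008, §7 (arXiv p. 17)] [cite: Lasserre2006, (3.12) (p. 9)] -/
theorem le_three_halves_of_block_nonneg {γ : ℝ} {q h : Fin 3 → MvPolynomial (Fin 3) ℝ}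
    (hq : ∀ k, q k ∈ supported ℝ (Δ k : Set (Fin 3))) (hpos : ∀ k, ∀ x ∈ Kb k, 0 ≤ eval x (q k))
    (heq : f - C γ = ∑ k, q k + ∑ i, h i * bool i) : γ ≤ 3 / 2 := by
  have h1 : L (f - C γ) = 3 / 2 - γ := by rw [L_sub, L_f, L_C]
  have h2 : L (f - C γ) = ∑ k, L (q k) := by
    rw [heq, L_add, L_sum, L_sum]
    simp [L_mul_bool]
  have h3 : 0 ≤ ∑ k, L (q k) := Finset.sum_nonneg fun k _ => L_nonneg_of_block (hq k) (hpos k)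
  linarith

/-! ### §5 The sparse bound is exactly `3/2` -/

/-- A SPARSE certificate of `γ` in the sense of Lasserre's `Q*_r` (3.12), all orders at once:
`f − γ = Σ_k (s₀ k + s₁ k · edge k + Σ_{i ∈ Δ_k} t k i · bool i)` with `s₀ k, s₁ k` block sums
of squares over `Δ_k` and block multipliers `t k i ∈ ℝ[x_{Δ_k}]` for the Boolean equalities.
[cite: Lasserre2006, (3.12) (p. 9)] [cite: NieDemmel2008, §7 (arXiv p. 17)] -/
def HasSparseCertificate (γ : ℝ) : Prop :=
  ∃ (s₀ s₁ : Fin 3 → MvPolynomial (Fin 3) ℝ) (t : Fin 3 → Fin 3 → MvPolynomial (Fin 3) ℝ),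
    (∀ k, IsBlockSos (Δ k : Set (Fin 3)) (s₀ k)) ∧ (∀ k, IsBlockSos (Δ k : Set (Fin 3)) (s₁ k)) ∧
    (∀ k, ∀ i ∈ Δ k, t k i ∈ supported ℝ (Δ k : Set (Fin 3))) ∧
    f - C γ = ∑ k, (s₀ k + s₁ k * edge k + ∑ i ∈ Δ k, t k i * bool i)

/-- Every sparse certificate certifies at most `3/2`. [cite: NieDemmel2008, §7 (arXiv p. 17)] -/
theorem HasSparseCertificate.le {γ : ℝ} (h : HasSparseCertificate γ) : γ ≤ 3 / 2 := by
  obtain ⟨s₀, s₁, t, hs₀, hs₁, ht, heq⟩ := h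
  refine le_three_halves_of_block_nonneg (q := fun k => s₀ k + s₁ k * edge k +
    ∑ i ∈ Δ k, t k i * bool i) (h := fun _ => 0) (fun k => ?_) (fun k x hx => ?_) ?_
  · exact Subalgebra.add_mem _ (Subalgebra.add_mem _ (hs₀ k).isSumSq_and_mem.2
      (Subalgebra.mul_mem _ (hs₁ k).isSumSq_and_mem.2 (edge_mem_supported k)))
      (Subalgebra.sum_mem _ fun i hi => Subalgebra.mul_mem _ (ht k i hi) (bool_mem_supported hi))
  · have hb : ∀ i ∈ Δ k, eval x (t k i * bool i) = 0 := fun i hi => by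
      rw [map_mul, hx.1 i hi, mul_zero]
    rw [map_add, map_sum, Finset.sum_eq_zero hb, add_zero, map_add, map_mul]
    exact add_nonneg (eval_nonneg_of_isSumSq (hs₀ k).isSumSq x)
      (mul_nonneg (eval_nonneg_of_isSumSq (hs₁ k).isSumSq x) hx.2)
  · rw [heq]; simp

/-- `γ ≤ 3/2` IS sparsely certified, with constant multipliers:
`f − γ = Σ_k ((3/2 − γ)/3 + ½ · edge k)`. [cite: NieDemmel2008, §7 (arXiv p. 17)] -/
theorem hasSparseCertificate_of_le {γ : ℝ} (hγ : γ ≤ 3 / 2) : HasSparseCertificate γ := by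
  refine ⟨fun _ => C ((3 / 2 - γ) / 3), fun _ => C (1 / 2), fun _ _ => 0,
    fun k => isBlockSos_C _ (by linarith), fun k => isBlockSos_C _ (by norm_num),
    fun k i _ => Subalgebra.zero_mem _, ?_⟩
  apply MvPolynomial.funext
  intro x
  simp only [map_sub, eval_f, eval_C, map_add, map_mul, eval_edge, zero_mul,
    Finset.sum_const_zero, add_zero, Fin.sum_univ_three, Δ_zero, Δ_one, Δ_two]
  rw [Finset.sum_pair (by decide), Finset.sum_pair (by decide), Finset.sum_pair (by decide)]
  ring

/-- ★★ **The sparse SOS bound is exactly `3/2` (at every relaxation order `r ≥ 1`), while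
`f* = 2`.** [cite: NieDemmel2008, §7 (arXiv p. 17)] -/
theorem hasSparseCertificate_iff {γ : ℝ} : HasSparseCertificate γ ↔ γ ≤ 3 / 2 :=
  ⟨HasSparseCertificate.le, hasSparseCertificate_of_le⟩

/-- ★★ The set of sparsely certified lower bounds is `(−∞, 3/2]`: «the lower bounds given by sparse
SOS relaxations are at most 3/2 … The sparse SOS relaxations do not converge for this example»
(`f* = 2`, `isLeast_eval_f`). [cite: NieDemmel2008, §7 (arXiv p. 17)] -/
theorem sparseBound_eq : {γ : ℝ | HasSparseCertificate γ} = Set.Iic (3 / 2) :=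
  Set.ext fun _ => hasSparseCertificate_iff

/-! ### §6 The contrast: the dense certificate is exact -/

/-- A DENSE Putinar certificate of `γ` (one s.o.s. in all variables, s.o.s. multipliers of the
edge constraints, the Boolean ideal): `f − γ = σ₀ + Σ_k σ_k · edge k + Σ_i h_i · bool i`.
[cite: NieDemmel2008, §7 (arXiv p. 17)] -/
def HasDenseCertificate (γ : ℝ) : Prop :=
  ∃ (σ₀ : MvPolynomial (Fin 3) ℝ) (σ₁ h : Fin 3 → MvPolynomial (Fin 3) ℝ),
    IsSumSq σ₀ ∧ (∀ k, IsSumSq (σ₁ k)) ∧ f - C γ = σ₀ + ∑ k, σ₁ k * edge k + ∑ i, h i * bool i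

/-- Sparse certificates are dense certificates. [cite: Lasserre2006, (3.12) (p. 9)] -/
theorem HasSparseCertificate.hasDenseCertificate {γ : ℝ} (h : HasSparseCertificate γ) :
    HasDenseCertificate γ := by
  classical
  obtain ⟨s₀, s₁, t, hs₀, hs₁, -, heq⟩ := h
  refine ⟨∑ k, s₀ k, s₁, fun i => ∑ k, if i ∈ Δ k then t k i else 0,
    IsSumSq.sum fun k _ => (hs₀ k).isSumSq, fun k => (hs₁ k).isSumSq, ?_⟩
  rw [heq]
  simp only [Finset.sum_add_distrib, add_right_inj]
  have hL : ∀ k, ∑ i ∈ Δ k, t k i * bool i = ∑ i, if i ∈ Δ k then t k i * bool i else 0 :=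
    fun k => by rw [← Finset.sum_filter, Finset.filter_mem_eq_inter, Finset.univ_inter]
  have hR : ∀ i, (∑ k, if i ∈ Δ k then t k i else 0) * bool i =
      ∑ k, if i ∈ Δ k then t k i * bool i else 0 := fun i => by
    rw [Finset.sum_mul]
    exact Finset.sum_congr rfl fun k _ => by split_ifs <;> simp
  simp_rw [hL, hR]
  exact Finset.sum_comm

/-- A dense certificate certifies at most `f* = 2` (evaluate at `(1,1,0) ∈ K`).
[cite: NieDemmel2008, §7 (arXiv p. 17)] -/
theorem HasDenseCertificate.le {γ : ℝ} (h : HasDenseCertificate γ) : γ ≤ 2 := by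
  obtain ⟨σ₀, σ₁, h, hσ₀, hσ₁, heq⟩ := h
  have hK := ind_Δ_zero_mem_K
  have hev := congr_arg (eval (ind (Δ 0))) heq
  rw [map_sub, eval_ind_Δ_zero_f, eval_C] at hev
  have hb : ∀ i ∈ (Finset.univ : Finset (Fin 3)), eval (ind (Δ 0)) (h i * bool i) = 0 :=
    fun i _ => by rw [map_mul, hK.1 i, mul_zero]
  rw [map_add, map_add, map_sum, map_sum, Finset.sum_eq_zero hb, add_zero] at hev
  have h0 : 0 ≤ eval (ind (Δ 0)) σ₀ := eval_nonneg_of_isSumSq hσ₀ _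
  have h1 : 0 ≤ ∑ k, eval (ind (Δ 0)) (σ₁ k * edge k) := Finset.sum_nonneg fun k _ => by
    rw [map_mul]
    exact mul_nonneg (eval_nonneg_of_isSumSq (hσ₁ k) _) (hK.2 k)
  linarith

/-- The dense s.o.s. `σ₀ = (1 − e₁ + e₂)²`. [cite: NieDemmel2008, §7 (arXiv p. 17)] -/
def σ₀ : MvPolynomial (Fin 3) ℝ :=
  (1 - (X 0 + X 1 + X 2) + (X 0 * X 1 + X 0 * X 2 + X 1 * X 2)) ^ 2

/-- The edge multipliers `σ_k = (Π_{i ∈ Δ_k} (1 − x_i))²` (block polynomials).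
[cite: NieDemmel2008, §7 (arXiv p. 17)] -/
def σe (k : Fin 3) : MvPolynomial (Fin 3) ℝ := (∏ i ∈ Δ k, (1 - X i)) ^ 2

/-- The Boolean-ideal multipliers of the dense certificate. [cite: NieDemmel2008, §7 (arXiv p. 17)] -/
def hd : Fin 3 → MvPolynomial (Fin 3) ℝ :=
  ![3 - 2 * X 0 - 3 * X 1 - 3 * X 2 + 2 * X 0 * X 1 + 2 * X 0 * X 2 - 2 * X 1 * X 2 + 3 * X 1 ^ 2
      + 3 * X 2 ^ 2 - X 0 * X 1 ^ 2 - X 0 * X 2 ^ 2 - X 1 ^ 3 - X 2 ^ 3,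
    3 - X 0 - 2 * X 1 - 3 * X 2 + X 0 * X 1 - 2 * X 0 * X 2 + 2 * X 1 * X 2 + 3 * X 2 ^ 2
      - X 1 * X 2 ^ 2 - X 2 ^ 3,
    3 - X 0 - X 1 - 2 * X 2 - 2 * X 0 * X 1 + X 0 * X 2 + X 1 * X 2]

/-- ★ The explicit dense certificate of `f* = 2`:
`f − 2 = (1 − e₁ + e₂)² + Σ_k (Π_{i∈Δ_k}(1 − x_i))² · edge k + Σ_i hd i · (x_i² − x_i)`.
[cite: NieDemmel2008, §7 (arXiv p. 17)] -/
theorem dense_certificate : f - C 2 = σ₀ + ∑ k, σe k * edge k + ∑ i, hd i * bool i := by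
  rw [f_eq, show (C (2 : ℝ) : MvPolynomial (Fin 3) ℝ) = 2 from map_ofNat C 2]
  simp only [Fin.sum_univ_three, σ₀, σe, edge, bool, hd, Δ_zero, Δ_one, Δ_two,
    Matrix.cons_val_zero, Matrix.cons_val_one, Matrix.cons_val_two, Matrix.head_cons,
    Matrix.tail_cons]
  rw [Finset.sum_pair (by decide), Finset.sum_pair (by decide), Finset.sum_pair (by decide),
    Finset.prod_pair (by decide), Finset.prod_pair (by decide), Finset.prod_pair (by decide)]
  ring

/-- `σ₀` is a square. [cite: NieDemmel2008, §7 (arXiv p. 17)] -/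
theorem isSumSq_σ₀ : IsSumSq σ₀ := by
  rw [σ₀, sq]; exact IsSumSq.mul_self _

/-- `σ_k` is a block sum of squares over `Δ_k`. [cite: NieDemmel2008, §7 (arXiv p. 17)] -/
theorem isBlockSos_σe (k : Fin 3) : IsBlockSos (Δ k : Set (Fin 3)) (σe k) := by
  refine isBlockSos_iff.2 ⟨by rw [σe, sq]; exact IsSumSq.mul_self _, Subalgebra.pow_mem _ ?_ _⟩
  exact Subalgebra.prod_mem _ fun i hi => Subalgebra.sub_mem _ (Subalgebra.one_mem _)
    ((X_mem_supported (R := ℝ)).2 (Finset.mem_coe.2 hi))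

/-- `f* = 2` is densely certified. [cite: NieDemmel2008, §7 (arXiv p. 17)] -/
theorem hasDenseCertificate_two : HasDenseCertificate 2 :=
  ⟨σ₀, σe, hd, isSumSq_σ₀, fun k => (isBlockSos_σe k).isSumSq, dense_certificate⟩

/-- Every `γ ≤ 2` is densely certified (`f − γ = (f − 2) + (2 − γ)`).
[cite: NieDemmel2008, §7 (arXiv p. 17)] -/
theorem hasDenseCertificate_of_le {γ : ℝ} (hγ : γ ≤ 2) : HasDenseCertificate γ := by
  refine ⟨σ₀ + C (Real.sqrt (2 - γ)) * C (Real.sqrt (2 - γ)), σe, hd,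
    isSumSq_σ₀.add (IsSumSq.mul_self _), fun k => (isBlockSos_σe k).isSumSq, ?_⟩
  rw [← map_mul, Real.mul_self_sqrt (by linarith), map_sub]
  linear_combination dense_certificate

/-- ★ **The dense Putinar relaxation is exact: it certifies exactly `(−∞, 2] = (−∞, f*]`**, in
contrast with the sparse `(−∞, 3/2]` (`sparseBound_eq`). [cite: NieDemmel2008, §7 (arXiv p. 17)] -/
theorem hasDenseCertificate_iff {γ : ℝ} : HasDenseCertificate γ ↔ γ ≤ 2 :=
  ⟨HasDenseCertificate.le, hasDenseCertificate_of_le⟩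

/-- [cite: NieDemmel2008, §7 (arXiv p. 17)] -/
theorem denseBound_eq : {γ : ℝ | HasDenseCertificate γ} = Set.Iic 2 :=
  Set.ext fun _ => hasDenseCertificate_iff

/-- The gap in one line: `3/2` is the best sparse bound, `2` the best dense bound `= f*`.
[cite: NieDemmel2008, §7 (arXiv p. 17)] -/
theorem sparse_gap : IsGreatest {γ : ℝ | HasSparseCertificate γ} (3 / 2) ∧
    IsGreatest {γ : ℝ | HasDenseCertificate γ} 2 ∧ IsLeast ((fun x => eval x f) '' K) 2 := by
  rw [sparseBound_eq, denseBound_eq]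
  exact ⟨isGreatest_Iic, isGreatest_Iic, isLeast_eval_f⟩

/-! ### §7 The tie to correlative sparsity: the csp graph is the triangle -/

/-- The constraint family `(edge 0, edge 1, edge 2, bool 0, bool 1, bool 2)`.
[cite: NieDemmel2008, §7 (arXiv p. 17)] -/
def constr : Fin 3 ⊕ Fin 3 → MvPolynomial (Fin 3) ℝ := Sum.elim edge bool

/-- The coefficient of `x_i` in `edge k` is `1` for `i ∈ Δ_k`. [cite: WakiEtAl2006, §3.2 (p. 222)] -/
theorem coeff_single_edge {k i : Fin 3} (hi : i ∈ Δ k) :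
    coeff (Finsupp.single i 1) (edge k) = 1 := by
  classical
  have hX : ∀ j : Fin 3, coeff (Finsupp.single i 1) (X j : MvPolynomial (Fin 3) ℝ) =
      if j = i then 1 else 0 := fun j => by
    rw [coeff_X]
    simp only [Finsupp.single_left_inj one_ne_zero]
  have h1 : coeff (Finsupp.single i 1) (1 : MvPolynomial (Fin 3) ℝ) = 0 := by
    rw [coeff_one, if_neg]
    intro h
    simpa using (Finsupp.ext_iff.1 h i).symm
  rw [edge, coeff_sub, coeff_sum, h1, sub_zero, Finset.sum_eq_single_of_mem i hi
    (fun j _ hji => by rw [hX, if_neg hji]), hX, if_pos rfl]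

/-- `i ∈ vars (edge k)` for `i ∈ Δ_k`. [cite: WakiEtAl2006, §3.2 (p. 222)] -/
theorem mem_vars_edge {k i : Fin 3} (hi : i ∈ Δ k) : i ∈ (edge k).vars := by
  rw [mem_vars_iff_mem_support]
  refine ⟨Finsupp.single i 1, ?_, by simp⟩
  rw [mem_support_iff, coeff_single_edge hi]
  exact one_ne_zero

/-- ★ Waki's correlative sparsity pattern graph of the problem `(f, constr)` is COMPLETE (the
triangle): every pair of variables shares an edge constraint.  Its only maximal clique is
`{x_0,x_1,x_2}`, so the chordal-csp recipe of `CorrelativeSparsityCertificates` produces the single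
dense block — whose relaxation is exact (`hasDenseCertificate_iff`) — and never the
RIP-violating cover `Δ`. [cite: WakiEtAl2006, §3.2 (p. 222)] [cite: NieDemmel2008, §7 (arXiv p. 17)] -/
theorem cspGraph_eq_top : cspGraph f constr = ⊤ := by
  ext i j
  simp only [SimpleGraph.top_adj]
  refine ⟨fun h => h.ne, fun hij => ?_⟩
  rw [cspGraph, SimpleGraph.fromRel_adj]
  obtain ⟨k, hi, hj⟩ := exists_pair_subset_Δ hij
  exact ⟨hij, Or.inl (Or.inr ⟨Sum.inl k, mem_vars_edge hi, mem_vars_edge hj⟩)⟩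

/-- The only maximal clique of the csp graph is `{x_0, x_1, x_2}`: the csp recipe yields the single
dense block. [cite: WakiEtAl2006, §3.2 (p. 222)] -/
theorem maximal_isClique_cspGraph_iff {S : Set (Fin 3)} :
    Maximal (cspGraph f constr).IsClique S ↔ S = Set.univ := by
  rw [cspGraph_eq_top]
  have hc : ∀ T : Set (Fin 3), (⊤ : SimpleGraph (Fin 3)).IsClique T :=
    fun T a _ b _ hab => (SimpleGraph.top_adj a b).2 hab
  constructor
  · intro h
    exact Set.eq_univ_of_univ_subset (h.2 (hc _) (Set.subset_univ S))
  · rintro rfl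
    exact ⟨hc _, fun T _ _ => Set.subset_univ T⟩

end Literature.Algebra.Polynomial.SparseSosWithoutRunningIntersection
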